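import Summits.CriticalPhenomena.SAWScalingLimit.Theorems.SAWLoopFugacityFlowAvoidanceLimitInteriorRatioLimitSubharmonic

/-!
# The zero extension of a nonnegative `P_{H|Λ}`-harmonic function is lattice-subharmonic
— UBHP step-zero brick B-sub of line `symplectic-fermion-anchor`
(crux `SAWLoopFugacityFlow.AvoidanceLimit`, stmt-CriticalPhenomena-10649; lead c3)

The uniform boundary Harnack principle `stub_uniformBHP` (UBHP) of the line concerns functions
`h : Λ → ℝ` on the volume `Λ = meshDomainFinset D δ` that are harmonic for the EDGE-killed walk of
`Ω_δ = discreteDomainGraph D δ`: `(P h)(x) = h(x)` with `P = ¼·adjMat Ω_δ Λ`. The tree's upper-bound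
technology for discrete harmonic functions on `ℤ²` — maximum principle, two-constant bound, weak
Beurling estimate (`LatticeLaplacian.lean`, `LatticeHarmonicMeasure.lean`, `WeakBeurlingEstimate.lean`,
`WeakBeurlingHoleFree.lean`) — is phrased for `IsLatticeSubharmonicOn`, the nearest-neighbour (SITE)
Laplacian. This file proves the one-line dictionary that makes all of it available to UBHP, for ANY
subgraph `H ≤ ℤ²`, volume `Λ` and region `T`:

* `isLatticeSubharmonicOn_dite_of_transition_mulVec_eq` (registered signature) — if `h ≥ 0` on `Λ`
  and `(P h)(x) = h(x)` at every `x ∈ Λ ∩ T`, then the zero extension `h̃` of `h` off `Λ` satisfies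
  `Δ h̃ ≥ 0` on `T`: at `x ∈ Λ ∩ T` the four lattice neighbours contain the `H|_Λ`-neighbours, where
  `h̃ = h` sums to `4 h(x)`, and the remaining terms are `≥ 0`; at `x ∈ T ∖ Λ`, `h̃(x) = 0 ≤` the
  neighbour sum.

This is the analogue, for arbitrary harmonic `h`, of `greenEntry_subharmonicOn` (the Green's column,
`…InteriorRatioLimitSubharmonic.lean`). Sources: folklore. No definitions.
-/

noncomputable section

open scoped BigOperators Classical
open Finset
open Literature.Probability.RandomPlanarGeometry Literature.Probability.LatticeModels

namespace Summit.CriticalPhenomena.SAWScalingLimit.Theorems.AvoidanceLimit.Anchor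

open KilledGreen

/-- The `P`-average at `x ∈ Λ` of `h : Λ → ℝ` is at most a quarter of the lattice-neighbour sum of its
zero extension, when `h ≥ 0` (`H ≤ ℤ²`: the `H|_Λ`-neighbours of `x` are among its four lattice
neighbours, and the dropped terms are nonnegative). [folklore] -/
theorem transition_mulVec_le_quarter_sum_dite {H : SimpleGraph (Site 2)} (hH : H ≤ zdGraph 2)
    (Λ : Finset (Site 2)) {h : ↥Λ → ℝ} (hnn : ∀ x, 0 ≤ h x) (x : ↥Λ) :
    Matrix.mulVec ((4 : ℝ)⁻¹ • adjMat H Λ) h x ≤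
      (4 : ℝ)⁻¹ * ∑ z ∈ (zdGraph 2).neighborFinset (x : Site 2),
        (fun v => if hv : v ∈ Λ then h ⟨v, hv⟩ else 0) z := by
  rw [transition_mulVec_apply]
  refine mul_le_mul_of_nonneg_left ?_ (by norm_num)
  -- rewrite the `P`-sum as a sum over the image in `Site 2`
  have h1 : ∑ y ∈ univ.filter (fun y : ↥Λ => H.Adj x.1 y.1), h y =
      ∑ z ∈ (univ.filter (fun y : ↥Λ => H.Adj x.1 y.1)).map (Function.Embedding.subtype _),
        (fun v => if hv : v ∈ Λ then h ⟨v, hv⟩ else 0) z := by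
    rw [Finset.sum_map]
    refine Finset.sum_congr rfl fun y _ => ?_
    simp
  rw [h1]
  exact Finset.sum_le_sum_of_subset_of_nonneg (map_filter_adj_subset Λ hH x)
    fun z _ _ => by
      by_cases hz : z ∈ Λ
      · simp only [hz, dite_true]; exact hnn _
      · simp [hz]

/-- **Registered brick B-sub.** For every subgraph `H ≤ ℤ²`, volume `Λ`, region `T` and nonnegative
`h : Λ → ℝ` that is `P_{H|Λ}`-harmonic at every vertex of `Λ` lying in `T`
(`(¼·adjMat H Λ) h = h` there), the zero extension of `h` off `Λ` is lattice-SUBharmonic on `T`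
(`Δ ≥ 0` for the nearest-neighbour Laplacian of `ℤ²`). Hence the tree's maximum principle,
two-constant bound and weak Beurling estimates apply to nonnegative harmonic functions of the
edge-killed `Ω_δ`-walk. [folklore] -/
theorem isLatticeSubharmonicOn_dite_of_transition_mulVec_eq :
    ∀ (H : SimpleGraph (Site 2)), H ≤ zdGraph 2 → ∀ (Λ : Finset (Site 2)) (T : Set (Site 2))
      (h : ↥Λ → ℝ), (∀ x, 0 ≤ h x) →
      (∀ x : ↥Λ, (x : Site 2) ∈ T → Matrix.mulVec ((4 : ℝ)⁻¹ • adjMat H Λ) h x = h x) →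
      IsLatticeSubharmonicOn (fun v => if hv : v ∈ Λ then h ⟨v, hv⟩ else 0) T := by
  intro H hH Λ T h hnn hharm
  set g : Site 2 → ℝ := fun v => if hv : v ∈ Λ then h ⟨v, hv⟩ else 0 with hg
  have hg_nonneg : ∀ z, 0 ≤ g z := fun z => by
    by_cases hz : z ∈ Λ
    · simp only [hg, hz, dite_true]; exact hnn _
    · simp [hg, hz]
  intro v hv
  rw [latticeLaplacian_eq, sum_cornerUnit_eq_sum_neighborFinset v g]
  by_cases hvΛ : v ∈ Λ
  · -- at a vertex of `Λ`: the `P`-average is `h v`, and it is below a quarter of the neighbour sum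
    have key := transition_mulVec_le_quarter_sum_dite hH Λ hnn ⟨v, hvΛ⟩
    rw [hharm ⟨v, hvΛ⟩ hv] at key
    have h4 : g v = h ⟨v, hvΛ⟩ := by simp [hg, hvΛ]
    rw [h4]
    have key' : h ⟨v, hvΛ⟩ ≤ 4⁻¹ * ∑ z ∈ (zdGraph 2).neighborFinset v, g z := key
    linarith
  · -- off `Λ` the extension vanishes and the neighbour sum is nonnegative
    have h0 : g v = 0 := by simp [hg, hvΛ]
    rw [h0, mul_zero, sub_zero]
    exact Finset.sum_nonneg fun z _ => hg_nonneg z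

end Summit.CriticalPhenomena.SAWScalingLimit.Theorems.AvoidanceLimit.Anchor

end
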